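import Mathlib
import HarnessLib
import Summits.SmoothPoincare4.SmoothPoincare4.Theses.VerlindeRLinks
import Literature.Topology.FourManifolds.RLinkSphere
import Literature.Topology.FourManifolds.RLinkSphereHomotopySphereProofs
import Literature.Topology.FourManifolds.GluingProofs
import Literature.Topology.FourManifolds.Cobordism
import Literature.Topology.FourManifolds.LickorishWallace
import Literature.Topology.FourManifolds.SphereTwoProdCircleSumUniqueness
import Literature.Topology.FourManifolds.FreeFundamentalGroupThreeManifoldHempel
import Literature.Topology.FourManifolds.LinkSurgeryFramedUniqueness
import Literature.Topology.FourManifolds.PropertyRTraceBridgeOfPropertyRHolds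
import Literature.Topology.FourManifolds.HandleAttachingMapsExistence

/-!
# Line `kirby-lemma21` (lead's reshape, 2026-08-17) — crux `VerlindeRLinks.VrlComponentsHBallSlice`
# (stmt-SmoothPoincare4-15874)

Crux (route `route-SmoothPoincare4-VerlindeRLinks`, item #9, Gompf–Scharlemann–Thompson 2010 Prop. 2.3
(Hillman), componentwise): every component `L.component i` of an R-link `L ⊂ S³` (`n` components, the
integral surgery `Y` on `L` is `#ⁿ(S² × S¹)` in the sense `IsSphereTwoProdCircleSum n Y`) is slice in a
homotopy `4`-ball (`Knot.IsHomotopyBallSlice`).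

THE LINE.  There is only one proof: close the trace `X_L = B⁴ ∪_L (2-handles)` with `♮ⁿ S¹ × B³` to the
R-link sphere `Σ_L`, a homotopy `4`-sphere (PROVED: `IsRLinkSphere.nonempty_homotopyEquiv_sphere_holds`),
and take the cores of the `2`-handles.  This file is the LEAD'S RESHAPE of the strategist's registered
skeleton (same composition idea, same seams), re-cut ONE LEVEL LOWER — at Kosinski's attaching maps
`gᵢ : T → D⁴` built from framed tubes `νᵢ` by the RADIAL collar of `D⁴`,
`gᵢ y = (1 - depth(y)/4) · νᵢ (angle y, fibre y)` — so that

* the typing slack recorded on the line card (a `Realization` only makes the open UNIT-DISC tubes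
  `νᵢ(S¹ × B²(1))` disjoint, while `IsIntegralSurgeryLink` wants the FULL ranges `range νᵢ` pairwise
  disjoint) never arises: the tubes are chosen with disjoint full ranges BEFORE the handles are attached
  (`stub_exists_disjoint_framedTubes`), and Kirby's Lemma 2.1 for links
  (`stub_isSurgery_boundary_of_isMultiAttachment`) consumes exactly these data;
* the cores of the `2`-handles (`stub_core_isSliceDiscIn_of_isMultiAttachment`) are read in the CONCRETE
  attachment, where the `i`-th core, seen from `D⁴`, is the cone `{s · Kᵢ(u) : 3/4 < s < 1} ∪ {centre}`
  over the RADIALLY pushed-in knot (Kosinski's `α` preserves `x_μ = 0`: the punctured core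
  `{(r u, 0)}` of the handle is glued to `gᵢ (√(1 - r²) u, 0) = (1 - r²/4) · Kᵢ(u)`), so the slice disc
  of `L.component i` off the shrunken `0`-handle `e(𝔻⁴) = (3/4) D⁴` is ONE radial formula
  `ρ u ↦ (1 - ρ²/4) · Kᵢ(u)` continued by the handle chart at `ρ = 0` — no appeal to an abstract
  `IsRLinkSphere X L`, whose realization would leave the interior values of the attaching maps
  uncontrolled;
* the attaching map of ONE framed tube (`stub_attachingMap_of_tube`) is the tree's `TubeAttachData`
  construction (`HandleAttachingMapOfTube.lean`) for the datum `closedBallBoundaryData 3` and its radial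
  collar `closedBallCollar` (`(x, t) ↦ (1 - t/2) x`, discharged `isSmoothEmbedding_closedBallCollarMap_holds`)
  with `κ = 1`, `δ = 1/2`;
* the compact trace `P` itself comes, in the sorry-free composition, from the DISCHARGED fact
  `HandleAttachingMap.exists_isMultiAttachment_holds`, `L.IsTrace P` is the realization record with
  carved ball `𝔻 4` (as in `HandleAttachingMap.exists_isTrace_of_isMultiAttachment`), and the two
  bookkeeping consequences of the radial formula (boundary values on `T ∩ ∂D⁴`; disjoint ranges) are
  proved here (`boundaryValues_of_radial`, `pairwise_disjoint_range_of_radial`);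
* `stub_oneHandlebody_boundary` (`∂(♮ⁿ S¹ × B³) = #ⁿ(S² × S¹)`) is VERBATIM the strategist's / `birth`'s.

Composition (sorry-free): `VrlComponentsHBallSlice_of` concludes the crux BY NAME from the five declared
stubs.  `sorry` occurs ONLY inside the five `stub_*` theorems.

## Disproof used

None exists (2026-08-17T12:00Z): `disproof_path` absent (no cdisprove session has written one), no dead
line, no landed `Negative/` lemma for this crux; `ledger negatives` has nothing on SmoothPoincare4.  The
statement is true on paper (refuter briefing on the item); the only recorded risk is CONVENTIONAL
(`IsSliceDiscIn`: boundary `= e ∘ K` on the unit sphere of the ball chart, open disc off the closed ball)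
and is met by `e := j ∘ glued ∘ (radial diffeo of ℝ⁴ onto a ball, `= (3/4)·id` on `𝔻⁴`)`.  The vendored
fact `GompfScharlemannThompson2010_prop23` (= the crux) is NOT used (costume).

## References

* R. C. Kirby, *The Topology of 4-Manifolds*, LNM 1374 (1989), Ch. I §2 (p. 8), Lemma 2.1, §5. [Kirby1989]
* R. E. Gompf, M. Scharlemann, A. Thompson, Geom. Topol. 14 (2010) 2305–2347 (arXiv:1103.1601),
  Prop. 2.3 and §9. [GompfScharlemannThompson2010]
* A. A. Kosinski, *Differential Manifolds* (1993), III §4, VI §6. [Kosinski1993]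
* R. E. Gompf, A. I. Stipsicz, *4-Manifolds and Kirby Calculus* (1999), §5.3, Prop. 5.1.2. [GompfStipsicz1999]
-/

-- `Summit.<Summit>.<Problem>`: single-conjunct summit, the duplicate component is mandated (CONVENTIONS §2).
set_option linter.dupNamespace false
set_option linter.unusedVariables false

noncomputable section

namespace Summit.SmoothPoincare4.SmoothPoincare4.Cruxes.VrlComponentsHBallSlice.KirbyLemma21

open scoped Manifold ContDiff Topology
open Set Function
open Literature.Topology.FourManifolds
open Summit.SmoothPoincare4.SmoothPoincare4.Theses.VerlindeRLinks

/-! ## The five registered stubs -/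

/-- **Stub 1a `stub_exists_disjoint_framedTubes` — fully disjoint framed tubes along a framed link.**
For every framed link `L ⊂ S³` with `n` components there are oriented tubular neighbourhoods `νᵢ` of the
components realising the framings `L.framing i` and with PAIRWISE DISJOINT (full) RANGES.  Why true /
how: pairwise disjoint tubes exist (`Link.exists_tubularNbhd_pairwise_disjoint`, `LinkTubularNbhd.lean`);
re-frame each to `L.framing i` by a twist, which keeps the range (`Knot.TubularNbhd.twist`,
`HasFraming.twist`/`range_twist`, `DehnSurgeryTwistProofs.lean`; this is how
`Knot.exists_tubularNbhd_hasFraming_holds` is proved).  Known (Rolfsen §9.F; Gompf–Stipsicz §4.5);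
size S/M. [Kirby1989, Ch. I §2 (p. 8)] [GompfStipsicz1999, §4.5] -/
theorem stub_exists_disjoint_framedTubes :
    ∀ (n : ℕ) (L : FramedLink (Fin n)),
      ∃ ν : ∀ i, Knot.TubularNbhd ⇑(L.component i),
        (∀ i, (ν i).HasFraming (L.framing i)) ∧
        Pairwise fun i j => Disjoint (range ⇑(ν i)) (range ⇑(ν j)) := by
  sorry

/-- **Stub 1b `stub_attachingMap_of_tube` — the radial attaching map of a tube.**  For every oriented
tubular neighbourhood `ν : S¹ × ℝ² ↪ S³` of a knot `K` there is a Kosinski attaching map `g : T → D⁴` of a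
`2`-handle on the `4`-disc (`HandleAttachingMap 3 2 (𝔻 4)`: a smooth embedding of the tube
`T = {x ∈ D⁴ | x_λ ≠ 0}` with open range taking `T ∩ ∂D⁴` into `∂D⁴`) given by the RADIAL formula
`g y = (1 - depth(y)/4) · ν (angle y, fibre y)` in the tube coordinates of `HandleAttachingMapOfTube.lean`
(`tubeAngle y = x_λ/|x_λ|`, `tubeFibre y = x_μ`, `tubeDepth y = 1 - ‖x‖²`).  Why true / how: this is
`TubeAttachData.map` for the datum `closedBallBoundaryData 3` (carrier literally `𝕊 3`,
`incl = Set.inclusion`), its radial collar `closedBallCollar isSmoothEmbedding_closedBallCollarMap_holds`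
(`(x, t) ↦ (1 - t/2) • x`, `ClosedBall.lean` / `ClosedBallCollarProofs.lean`), the tube `ν` restricted
to `S¹ × B(0, 2)` as an open partial homeomorphism with smooth inverse (`ν` is an open smooth embedding,
`Knot.TubularNbhd.isOpenEmbedding`), `κ = 1`, `δ = 1/2`; the `TubeAttachData` proofs
(`isSmoothEmbedding_map`, `isOpen_range_map`, `map_of_norm_eq_one`) use the datum only through general
`BoundaryData`/`Collar` lemmas (`Collar.isOpen_image_of_forall_lt_one`, `Collar.image_mem_nhds`,
`apply_bot`), so they transcribe to this datum.  Known (Kosinski III §4, VI §6); size M/L (mechanical).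
[Kosinski1993, III §4 and VI §6] -/
theorem stub_attachingMap_of_tube :
    ∀ (K : Knot) (ν : Knot.TubularNbhd ⇑K),
      ∃ g : HandleAttachingMap 3 2 (Metric.closedBall (0 : EuclideanSpace ℝ (Fin 4)) 1),
        ∀ y : ↥(handleTube 3 2),
          ((g.toFun y : Metric.closedBall (0 : EuclideanSpace ℝ (Fin 4)) 1) : EuclideanSpace ℝ (Fin 4)) =
            (1 - tubeDepth y / 4) •
              ((ν (tubeAngle y, tubeFibre y) : Metric.sphere (0 : EuclideanSpace ℝ (Fin 4)) 1) :
                EuclideanSpace ℝ (Fin 4)) := by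
  sorry

/-- **Stub 2 `stub_isSurgery_boundary_of_isMultiAttachment` — Kirby's Lemma 2.1 for links: the
boundary of `D⁴ ∪_{g} (2-handles)` is the surgery on `L`.**  If the attaching maps `gᵢ : T → D⁴` have
boundary values the oriented tubes `νᵢ` of `L.component i` (framings `L.framing i`, pairwise disjoint
full ranges) on the unit disc bundle of `T ∩ ∂D⁴`, and `P` is `D⁴` with the `2`-handles attached along
the `gᵢ` (`HandleAttachingMap.IsMultiAttachment g (𝓡∂ 4) P`), then for EVERY boundary datum `bP` of `P`
the boundary `3`-manifold `bP.carrier` is the integral surgery on `L` (`L.IsSurgery (𝓡 3) bP.carrier`,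
i.e. `IsIntegralSurgeryLink` presented with the very tubes `νᵢ`).  Why true / how: the case `n = 1` is
the tree theorem `HandleAttachingMap.isIntegralSurgery_boundary`; in general restrict the open
embeddings `jA` (along `x ↦ incl x` from `L.toLink.complement`, off all `n` attaching circles) and
`jB i` (along `beltBoundaryPt`, one solid torus per component) to the boundary
(`BoundaryData.boundaryRestrict`, `OpenEmbeddingBoundaryRestrict.lean`), and use that on `∂D⁴`
Kosinski's relation `x ∼ h̄ᵢ α x` IS `Link.surgeryRel ν i` (`glueRel_incl_beltBoundaryPt_iff`); the
solid tori are pairwise disjoint because the handle pieces are.  Known (Kirby 1989, Ch. I Lemma 2.1;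
Gompf–Stipsicz Prop. 5.1.2); size M (re-indexing of `AttachmentBoundaryPieces/Surgery.lean`).
[Kirby1989, Ch. I §2 Lemma 2.1] [GompfStipsicz1999, §5.3] -/
theorem stub_isSurgery_boundary_of_isMultiAttachment :
    ∀ (n : ℕ) (L : FramedLink (Fin n))
      (g : Fin n → HandleAttachingMap 3 2 (Metric.closedBall (0 : EuclideanSpace ℝ (Fin 4)) 1))
      (ν : ∀ i, Knot.TubularNbhd ⇑(L.component i)),
      (∀ i, (ν i).HasFraming (L.framing i)) →
      (Pairwise fun i j => Disjoint (range ⇑(ν i)) (range ⇑(ν j))) →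
      (∀ (i : Fin n) (y : ↥(handleTube 3 2)), tubeDepth y = 0 →
        (g i).toFun y = (closedBallBoundaryData 3).incl (ν i (tubeAngle y, tubeFibre y))) →
      ∀ (P : Type) [TopologicalSpace P] [ChartedSpace (EuclideanHalfSpace 4) P]
        [IsManifold (𝓡∂ 4) ((⊤ : ℕ∞) : WithTop ℕ∞) P],
        HandleAttachingMap.IsMultiAttachment g (𝓡∂ 4) P →
          ∀ bP : BoundaryData (𝓡∂ 4) P (𝓡 3), L.IsSurgery (𝓡 3) bP.carrier := by
  sorry

/-- **Stub 3 `stub_oneHandlebody_boundary` — `∂(♮ⁿ S¹ × B³) ≅ #ⁿ(S² × S¹)`** (VERBATIM the stub of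
`Lines/birth.lean` / the strategist's `kirby_lemma21`; one proof serves every line).  For every `n` there
is a compact connected orientable smooth `4`-manifold with boundary `V : Type` with a handle decomposition
into one `0`-handle and `n` `1`-handles (`HasHandleDecomposition 3 V (handleCount 1 n)`,
`IsOrientable (𝓡∂ 4) V`) and a boundary datum `bV` whose carrier is `#ⁿ(S² × S¹)` in the tree's recursive
sense `IsSphereTwoProdCircleSum n`.  Why true / how: `(1,n)`-handlebodies exist
(`exists_oneHandlebody_four n`) and are UNIQUE up to diffeomorphism
(`nonempty_diffeomorph_of_hasHandleDecomposition_handleCount_one_holds`, UNIQ₄), so ONE model with a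
recognisable boundary per `n` suffices (`HasHandleDecomposition`, `IsOrientable` and
`IsSphereTwoProdCircleSum` all transport along diffeomorphisms): induct with a boundary connected sum
`V_k ♮ V_1` (`∂(V_k ♮ V_1) = ∂V_k # ∂V_1`; `BoundaryConnectedSum*.lean`), or recognise `∂V` as the
`0`-surgery on the `n`-component unlink (dot–zero exchange, Kirby Lemma 2.1; then
`exists_isSurgery_zeroFramedUnlink_holds` + `FramedLink.IsSurgery.nonempty_diffeomorph_holds` +
`IsSphereTwoProdCircleSum.of_diffeomorph`), or pass the `n` index-`1` critical points of the model's Morse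
function one at a time (`LevelPassageSurgery.lean`: the level above is the type-`(1,3)` surgery of the
level below; `0`-surgery along a framed `S⁰` in a connected `3`-manifold is `· # (S² × S¹)`); `n = 0`:
`∂𝔻⁴ = S³`; `n = 1`: the discharged `nonempty_diffeomorph_boundary_sphereTwo_prod_of_handleCount_one_one_holds`
(pattern: `exists_isSphereTwoProdCircleSum_closed`).  Do NOT go through `π₁(∂V)` free + Hempel/Perelman
(H53 is conditional in the tree).  Known; size M/L. [Kirby1989, Ch. I §2 (p. 8)] [Kosinski1993, VI (11.4)] -/
theorem stub_oneHandlebody_boundary :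
    ∀ n : ℕ, ∃ (V : Type) (_ : TopologicalSpace V) (_ : T2Space V) (_ : SecondCountableTopology V)
      (_ : ChartedSpace (EuclideanHalfSpace 4) V) (_ : IsManifold (𝓡∂ 4) ((⊤ : ℕ∞) : WithTop ℕ∞) V)
      (_ : CompactSpace V) (_ : ConnectedSpace V) (bV : BoundaryData (𝓡∂ 4) V (𝓡 3)),
      HasHandleDecomposition 3 V (handleCount 1 n) ∧ IsOrientable (𝓡∂ 4) V ∧
        IsSphereTwoProdCircleSum n bV.carrier := by
  sorry

/-- **Stub 4 `stub_core_isSliceDiscIn_of_isMultiAttachment` — in `D⁴ ∪ (2-handles)` every component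
bounds the core of its `2`-handle, off a shrunken `0`-handle.**  Let the `2`-handles be attached to `D⁴`
along the RADIAL attaching maps `gᵢ y = (1 - depth(y)/4) · νᵢ (angle y, fibre y)` of tubes `νᵢ` of the
components of `L` (`HandleAttachingMap.IsMultiAttachment g (𝓡∂ 4) P`, embeddings
`glued : D⁴ ∖ ⋃ Kᵢ ↪ P`, `handlePiece i : D⁴ ∖ S ↪ P`), and let `j : P ↪ X` be any smooth embedding into
a boundaryless smooth `4`-manifold `X` (in the line: the gluing embedding of `Σ_L = P ∪_φ V`).  Then for
every `i` there are `e : ℝ⁴ → X`, `f : ℝ² → X` with `(L.component i).IsSliceDiscIn X e f`.  Why true /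
how (GST, proof of Prop. 2.3: "the cores of the original `n` `2`-handles … are the required `n`
`2`-disks"): Kosinski's inversion `α` preserves `x_μ = 0` (`handleInversion_eq_blockScale`), so the
punctured core `{(r u, 0) : 0 < r < 1}` of the `i`-th handle piece is glued
(`glued a = handlePiece i b ↔ (g i).glueRel a b`) to `gᵢ (√(1-r²) u, 0) = (1 - r²/4) · Kᵢ(u) ∈ D⁴`
(`Knot.TubularNbhd.apply_zero`): take `e := j ∘ glued ∘ τ` with `τ : ℝ⁴ ≅ B(0, 7/8)` a radial
diffeomorphism equal to `(3/4)·id` on `𝔻⁴` (pattern `RadialDiffeomorph.lean`), and `f (ρ u) :=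
j (glued (σ(ρ²) · Kᵢ(u)))` with `σ` smooth, `σ(t) = 1 - t/4` for `t ≤ 3/2`, `0 < σ < 1` beyond, patched
at `ρ = 0` by the handle chart `f x = j (handlePiece i ⟨lamEmbed x, _⟩)` (the two formulas agree on
`0 < ‖x‖ < 1`): `f` is smooth, injective and immersed on `𝔻²` (radial map over the embedded knot; the
handle chart at the centre, cf. `TubeNbhd.coreDisc` / `injective_mfderiv_coreDisc` in `OpenTrace.lean`),
`f (ρ u)` for `ρ < 1` has `D⁴`-radius `1 - ρ²/4 > 3/4` or is the unglued centre
(`glueRel.lamSq_ne_zero`), hence lies off `e(𝔻⁴) = j (glued ((3/4) 𝔻⁴))`, and `f u = j (glued ((3/4)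
Kᵢ u)) = e (Kᵢ u)` on `S¹`.  No disjointness of tubes and no `Y` is needed.  Size M.
[GompfScharlemannThompson2010, Prop. 2.3] [Kirby1989, Ch. I §2] [Kosinski1993, VI §6] -/
theorem stub_core_isSliceDiscIn_of_isMultiAttachment :
    ∀ (n : ℕ) (L : FramedLink (Fin n))
      (g : Fin n → HandleAttachingMap 3 2 (Metric.closedBall (0 : EuclideanSpace ℝ (Fin 4)) 1))
      (ν : ∀ i, Knot.TubularNbhd ⇑(L.component i)),
      (∀ (i : Fin n) (y : ↥(handleTube 3 2)),
        (((g i).toFun y : Metric.closedBall (0 : EuclideanSpace ℝ (Fin 4)) 1) : EuclideanSpace ℝ (Fin 4)) =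
          (1 - tubeDepth y / 4) •
            ((ν i (tubeAngle y, tubeFibre y) : Metric.sphere (0 : EuclideanSpace ℝ (Fin 4)) 1) :
              EuclideanSpace ℝ (Fin 4))) →
      ∀ (P : Type) [TopologicalSpace P] [T2Space P] [ChartedSpace (EuclideanHalfSpace 4) P]
        [IsManifold (𝓡∂ 4) ((⊤ : ℕ∞) : WithTop ℕ∞) P],
        HandleAttachingMap.IsMultiAttachment g (𝓡∂ 4) P →
        ∀ (X : Type) [TopologicalSpace X] [T2Space X] [ChartedSpace (EuclideanSpace ℝ (Fin 4)) X]
          [IsManifold (𝓡 4) ((⊤ : ℕ∞) : WithTop ℕ∞) X] (j : P → X),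
          Manifold.IsSmoothEmbedding (𝓡∂ 4) (𝓡 4) ((⊤ : ℕ∞) : WithTop ℕ∞) j →
          ∀ i : Fin n, ∃ (e : EuclideanSpace ℝ (Fin 4) → X) (f : EuclideanSpace ℝ (Fin 2) → X),
            (L.component i).IsSliceDiscIn X e f := by
  sorry

/-! ## Sorry-free composition, 0: bookkeeping of the radial attaching maps -/

section Radial

variable {n : ℕ} {L : FramedLink (Fin n)}
  {g : Fin n → HandleAttachingMap 3 2 (Metric.closedBall (0 : EuclideanSpace ℝ (Fin 4)) 1)}
  {ν : ∀ i, Knot.TubularNbhd ⇑(L.component i)}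

/-- **Boundary values of the radial attaching maps**: at depth `0` (i.e. on `T ∩ ∂D⁴`) the radial
formula `gᵢ y = (1 - depth(y)/4) · νᵢ (angle y, fibre y)` reads `gᵢ y = incl (νᵢ (angle y, fibre y))`
— the clause `carvedEmbed_handle` of `DottedCircleDiagram.Realization` with carved ball `𝔻 4`.
[Kosinski1993, VI §6] -/
theorem boundaryValues_of_radial
    (hg : ∀ (i : Fin n) (y : ↥(handleTube 3 2)),
      (((g i).toFun y : Metric.closedBall (0 : EuclideanSpace ℝ (Fin 4)) 1) : EuclideanSpace ℝ (Fin 4)) =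
        (1 - tubeDepth y / 4) •
          ((ν i (tubeAngle y, tubeFibre y) : Metric.sphere (0 : EuclideanSpace ℝ (Fin 4)) 1) :
            EuclideanSpace ℝ (Fin 4))) :
    ∀ (i : Fin n) (y : ↥(handleTube 3 2)), tubeDepth y = 0 →
      (g i).toFun y = (closedBallBoundaryData 3).incl (ν i (tubeAngle y, tubeFibre y)) := by
  intro i y hy
  apply Subtype.ext
  rw [hg i y, hy, coe_incl_three]
  simp

/-- **The radial attaching maps of disjoint tubes have disjoint ranges**: `gᵢ y = gⱼ y'` forces equal
`D⁴`-radii `1 - depth/4 ∈ (3/4, 1]`, hence equal directions `νᵢ (…) = νⱼ (…)`, impossible for `i ≠ j`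
when the tubes have disjoint ranges. [Kosinski1993, VI §6] -/
theorem pairwise_disjoint_range_of_radial
    (hν : Pairwise fun i j => Disjoint (range ⇑(ν i)) (range ⇑(ν j)))
    (hg : ∀ (i : Fin n) (y : ↥(handleTube 3 2)),
      (((g i).toFun y : Metric.closedBall (0 : EuclideanSpace ℝ (Fin 4)) 1) : EuclideanSpace ℝ (Fin 4)) =
        (1 - tubeDepth y / 4) •
          ((ν i (tubeAngle y, tubeFibre y) : Metric.sphere (0 : EuclideanSpace ℝ (Fin 4)) 1) :
            EuclideanSpace ℝ (Fin 4))) :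
    Pairwise fun i j => Disjoint (range (g i).toFun) (range (g j).toFun) := by
  intro i j hij
  refine Set.disjoint_left.2 ?_
  rintro _ ⟨y, rfl⟩ ⟨y', hy'⟩
  -- equal points of `D⁴` have equal radii and equal directions
  have hv : (1 - tubeDepth y' / 4) •
      ((ν j (tubeAngle y', tubeFibre y') : Metric.sphere (0 : EuclideanSpace ℝ (Fin 4)) 1) :
        EuclideanSpace ℝ (Fin 4)) =
      (1 - tubeDepth y / 4) •
      ((ν i (tubeAngle y, tubeFibre y) : Metric.sphere (0 : EuclideanSpace ℝ (Fin 4)) 1) :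
        EuclideanSpace ℝ (Fin 4)) := by
    rw [← hg j y', ← hg i y, hy']
  have hc : 0 < 1 - tubeDepth y / 4 := by
    have := tubeDepth_lt_one y; linarith
  have hc' : 0 < 1 - tubeDepth y' / 4 := by
    have := tubeDepth_lt_one y'; linarith
  have hn : 1 - tubeDepth y' / 4 = 1 - tubeDepth y / 4 := by
    have := congrArg norm hv
    rwa [norm_smul, norm_smul, Real.norm_of_nonneg hc.le, Real.norm_of_nonneg hc'.le,
      norm_eq_of_mem_sphere, norm_eq_of_mem_sphere, mul_one, mul_one] at this
  rw [hn] at hv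
  have hdir : (ν j (tubeAngle y', tubeFibre y') : Metric.sphere (0 : EuclideanSpace ℝ (Fin 4)) 1) =
      ν i (tubeAngle y, tubeFibre y) :=
    Subtype.ext (smul_right_injective _ hc.ne' hv)
  have hmem : (ν i (tubeAngle y, tubeFibre y) : Metric.sphere (0 : EuclideanSpace ℝ (Fin 4)) 1) ∈
      range ⇑(ν j) := ⟨_, hdir⟩
  exact Set.disjoint_left.1 (hν hij) (mem_range_self _) hmem

/-- **`D⁴` with `2`-handles attached along the radial attaching maps of framed tubes of the components
of `L` is a trace of `L`**: the realization record of `DottedCircleDiagram.ofFramedLink L` with carved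
ball `𝔻 4` itself (`carvedEmbed = Subtype.val`, no dual handles), exactly as in the `n = 1` theorem
`HandleAttachingMap.exists_isTrace_of_isMultiAttachment`. [Kirby1989, Ch. I §2 (p. 8)]
[Kosinski1993, VI §6] -/
theorem isTrace_of_isMultiAttachment (hfr : ∀ i, (ν i).HasFraming (L.framing i))
    (hbd : ∀ (i : Fin n) (y : ↥(handleTube 3 2)), tubeDepth y = 0 →
      (g i).toFun y = (closedBallBoundaryData 3).incl (ν i (tubeAngle y, tubeFibre y)))
    {P : Type} [TopologicalSpace P] [ChartedSpace (EuclideanHalfSpace 4) P]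
    (hP : HandleAttachingMap.IsMultiAttachment g (𝓡∂ 4) P) : L.IsTrace P := by
  obtain ⟨hdisj, jA, jB, hjA, hjAo, hjB, hcov, hglue, hdisjB⟩ := hP
  exact ⟨{
    carved := Metric.closedBall (0 : EuclideanSpace ℝ (Fin 4)) 1
    dual := fun i => i.elim0
    disjoint_dual := fun i => i.elim0
    carvedEmbed := Subtype.val
    discHandle := fun i => i.elim0
    isSmoothEmbedding_carvedEmbed := Manifold.IsSmoothEmbedding.of_opens _
    isOpen_range_carvedEmbed := by
      rw [Subtype.range_coe_subtype]
      exact (HandleAttachingMap.coresComplement _).isOpen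
    isSmoothEmbedding_discHandle := fun i => i.elim0
    isOpen_range_discHandle := fun i => i.elim0
    cover_closedBall := eq_univ_of_forall fun x => Or.inl ⟨⟨x, by simp⟩, rfl⟩
    carvedEmbed_eq_discHandle_iff := fun i => i.elim0
    disjoint_discHandle := fun i => i.elim0
    discHandle_beltDiscPt := fun i => i.elim0
    handle := g
    disjoint_handle := hdisj
    handle_mem := fun j y => (HandleAttachingMap.mem_coresComplement _).2 fun i => i.elim0
    tube := ν
    hasFraming_tube := hfr
    carvedEmbed_handle := fun j y hy => hbd j y hy
    glued := jA
    handlePiece := jB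
    isSmoothEmbedding_glued := hjA
    isOpen_range_glued := hjAo
    isSmoothEmbedding_handlePiece := fun j => (hjB j).1
    isOpen_range_handlePiece := fun j => (hjB j).2
    cover := hcov
    glued_eq_handlePiece_iff := hglue
    disjoint_handlePiece := hdisjB }⟩

end Radial

/-! ## Sorry-free composition, I: the five stubs give the crux -/

/-- **Composition with the five stub signatures as explicit hypotheses** (GST 2010, proof of Prop. 2.3
closed up as in §9): framed tubes with disjoint ranges (stub 1a) and their radial attaching maps
(stub 1b, one per component; boundary values and disjoint ranges by `boundaryValues_of_radial`,
`pairwise_disjoint_range_of_radial`); attach the handles (`HandleAttachingMap.exists_isMultiAttachment_holds`,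
discharged): a compact trace `P` (`isTrace_of_isMultiAttachment`) whose canonical boundary `∂P`
(`BoundaryManifold.boundaryData`) is a surgery on `L` (stub 2), hence `≅ Y` (uniqueness of link surgery,
`FramedLink.IsSurgery.nonempty_diffeomorph_holds`), hence `#ⁿ(S² × S¹)`; a `(1,n)`-handlebody `V` with
`∂V ≅ #ⁿ(S² × S¹) ≅ ∂P` (stub 3, `IsSphereTwoProdCircleSum.nonempty_diffeomorph`); glue `X = P ∪_φ V`
(`exists_isBoundaryGluing_holds`): an R-link sphere (`IsRLinkSphere.mk`), compact and `≃ₕ S⁴`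
(`IsRLinkSphere.nonempty_homotopyEquiv_sphere_holds`, PROVED); the core of the `i`-th handle read
through the gluing embedding `jP : P ↪ X` (stub 4) is an `IsSliceDiscIn` datum, whence
`Knot.IsSliceDiscIn.isHomotopyBallSlice`. [GompfScharlemannThompson2010, Prop. 2.3 and §9] -/
theorem isHomotopyBallSlice_of_stubs
    (hT : ∀ (n : ℕ) (L : FramedLink (Fin n)),
      ∃ ν : ∀ i, Knot.TubularNbhd ⇑(L.component i),
        (∀ i, (ν i).HasFraming (L.framing i)) ∧
        Pairwise fun i j => Disjoint (range ⇑(ν i)) (range ⇑(ν j)))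
    (hA : ∀ (K : Knot) (ν : Knot.TubularNbhd ⇑K),
      ∃ g : HandleAttachingMap 3 2 (Metric.closedBall (0 : EuclideanSpace ℝ (Fin 4)) 1),
        ∀ y : ↥(handleTube 3 2),
          ((g.toFun y : Metric.closedBall (0 : EuclideanSpace ℝ (Fin 4)) 1) : EuclideanSpace ℝ (Fin 4)) =
            (1 - tubeDepth y / 4) •
              ((ν (tubeAngle y, tubeFibre y) : Metric.sphere (0 : EuclideanSpace ℝ (Fin 4)) 1) :
                EuclideanSpace ℝ (Fin 4)))
    (hB : ∀ (n : ℕ) (L : FramedLink (Fin n))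
      (g : Fin n → HandleAttachingMap 3 2 (Metric.closedBall (0 : EuclideanSpace ℝ (Fin 4)) 1))
      (ν : ∀ i, Knot.TubularNbhd ⇑(L.component i)),
      (∀ i, (ν i).HasFraming (L.framing i)) →
      (Pairwise fun i j => Disjoint (range ⇑(ν i)) (range ⇑(ν j))) →
      (∀ (i : Fin n) (y : ↥(handleTube 3 2)), tubeDepth y = 0 →
        (g i).toFun y = (closedBallBoundaryData 3).incl (ν i (tubeAngle y, tubeFibre y))) →
      ∀ (P : Type) [TopologicalSpace P] [ChartedSpace (EuclideanHalfSpace 4) P]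
        [IsManifold (𝓡∂ 4) ((⊤ : ℕ∞) : WithTop ℕ∞) P],
        HandleAttachingMap.IsMultiAttachment g (𝓡∂ 4) P →
          ∀ bP : BoundaryData (𝓡∂ 4) P (𝓡 3), L.IsSurgery (𝓡 3) bP.carrier)
    (hV : ∀ n : ℕ, ∃ (V : Type) (_ : TopologicalSpace V) (_ : T2Space V) (_ : SecondCountableTopology V)
      (_ : ChartedSpace (EuclideanHalfSpace 4) V) (_ : IsManifold (𝓡∂ 4) ((⊤ : ℕ∞) : WithTop ℕ∞) V)
      (_ : CompactSpace V) (_ : ConnectedSpace V) (bV : BoundaryData (𝓡∂ 4) V (𝓡 3)),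
      HasHandleDecomposition 3 V (handleCount 1 n) ∧ IsOrientable (𝓡∂ 4) V ∧
        IsSphereTwoProdCircleSum n bV.carrier)
    (hC : ∀ (n : ℕ) (L : FramedLink (Fin n))
      (g : Fin n → HandleAttachingMap 3 2 (Metric.closedBall (0 : EuclideanSpace ℝ (Fin 4)) 1))
      (ν : ∀ i, Knot.TubularNbhd ⇑(L.component i)),
      (∀ (i : Fin n) (y : ↥(handleTube 3 2)),
        (((g i).toFun y : Metric.closedBall (0 : EuclideanSpace ℝ (Fin 4)) 1) : EuclideanSpace ℝ (Fin 4)) =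
          (1 - tubeDepth y / 4) •
            ((ν i (tubeAngle y, tubeFibre y) : Metric.sphere (0 : EuclideanSpace ℝ (Fin 4)) 1) :
              EuclideanSpace ℝ (Fin 4))) →
      ∀ (P : Type) [TopologicalSpace P] [T2Space P] [ChartedSpace (EuclideanHalfSpace 4) P]
        [IsManifold (𝓡∂ 4) ((⊤ : ℕ∞) : WithTop ℕ∞) P],
        HandleAttachingMap.IsMultiAttachment g (𝓡∂ 4) P →
        ∀ (X : Type) [TopologicalSpace X] [T2Space X] [ChartedSpace (EuclideanSpace ℝ (Fin 4)) X]
          [IsManifold (𝓡 4) ((⊤ : ℕ∞) : WithTop ℕ∞) X] (j : P → X),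
          Manifold.IsSmoothEmbedding (𝓡∂ 4) (𝓡 4) ((⊤ : ℕ∞) : WithTop ℕ∞) j →
          ∀ i : Fin n, ∃ (e : EuclideanSpace ℝ (Fin 4) → X) (f : EuclideanSpace ℝ (Fin 2) → X),
            (L.component i).IsSliceDiscIn X e f) :
    ∀ (n : ℕ) (L : FramedLink (Fin n)) (Y : Type) [TopologicalSpace Y] [T2Space Y]
      [SecondCountableTopology Y] [ChartedSpace (EuclideanSpace ℝ (Fin 3)) Y]
      [IsManifold (𝓡 3) ((⊤ : ℕ∞) : WithTop ℕ∞) Y] [CompactSpace Y] [ConnectedSpace Y],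
      IsSphereTwoProdCircleSum n Y → L.IsSurgery (𝓡 3) Y →
        ∀ i : Fin n, (L.component i).IsHomotopyBallSlice := by
  intro n L Y _ _ _ _ _ _ _ hY hL i
  -- stub 1a: framed tubes with disjoint ranges; stub 1b: their radial attaching maps
  obtain ⟨ν, hfr, hνdisj⟩ := hT n L
  choose g hg using fun i => hA (L.component i) (ν i)
  have hbd := boundaryValues_of_radial (L := L) hg
  have hgdisj := pairwise_disjoint_range_of_radial (L := L) hνdisj hg
  -- attach the handles: a compact trace `P` of `L` (Kosinski VI §6, discharged)
  obtain ⟨P, _, _, _, hP2, hPσ, hPc, hP⟩ :=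
    HandleAttachingMap.exists_isMultiAttachment_holds 3 2
      (Metric.closedBall (0 : EuclideanSpace ℝ (Fin 4)) 1) (Fin n) g hgdisj
  haveI : T2Space P := hP2
  haveI : SecondCountableTopology P := hPσ
  haveI : CompactSpace P := hPc inferInstance
  have hPt : L.IsTrace P := isTrace_of_isMultiAttachment hfr hbd hP
  -- its canonical boundary datum `∂P`
  let bP : BoundaryData (𝓡∂ 4) P (𝓡 3) := BoundaryManifold.boundaryData 3 P
  haveI : T2Space bP.carrier := bP.t2Space_carrier
  haveI : SecondCountableTopology bP.carrier := bP.secondCountableTopology_carrier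
  -- stub 2: `∂P` is a surgery on `L`; uniqueness of surgery: `Y ≅ ∂P`, so `∂P ≅ #ⁿ(S² × S¹)`
  have hbP : L.IsSurgery (𝓡 3) bP.carrier := hB n L g ν hfr hνdisj hbd P hP bP
  obtain ⟨ψ⟩ := FramedLink.IsSurgery.nonempty_diffeomorph_holds hL hbP
  have hsum : IsSphereTwoProdCircleSum n bP.carrier := hY.of_diffeomorph ψ
  -- stub 3: `V ≅ ♮ⁿ S¹ × B³` with `∂V ≅ #ⁿ(S² × S¹) ≅ ∂P`
  obtain ⟨V, _, _, _, _, _, _, _, bV, hVh, hVo, hbV⟩ := hV n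
  haveI : T2Space bV.carrier := bV.t2Space_carrier
  obtain ⟨φ⟩ := IsSphereTwoProdCircleSum.nonempty_diffeomorph n bP.carrier bV.carrier hsum hbV
  -- glue `X = P ∪_φ V`: an R-link sphere, compact and `≃ₕ S⁴`
  obtain ⟨X, _, _, _, _, _, _, hX⟩ := exists_isBoundaryGluing_holds (n := 3) bP bV φ
  have hR : IsRLinkSphere X L := IsRLinkSphere.mk hPt hVh hVo hX
  haveI : CompactSpace X := hR.compactSpace
  -- stub 4: the core of the `i`-th handle, read in `X` through the gluing embedding `jP`
  obtain ⟨jP, jV, hjP, -, -, -⟩ := hX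
  obtain ⟨e, f, hef⟩ := hC n L g ν hg P hP X jP hjP i
  exact hef.isHomotopyBallSlice (IsRLinkSphere.nonempty_homotopyEquiv_sphere_holds n L X hR)

/-- **THE SKELETON THEOREM.** The crux
`Summit.SmoothPoincare4.SmoothPoincare4.Theses.VerlindeRLinks.VrlComponentsHBallSlice`, concluded BY NAME
from the five DECLARED stubs `stub_exists_disjoint_framedTubes`, `stub_attachingMap_of_tube`,
`stub_isSurgery_boundary_of_isMultiAttachment`, `stub_oneHandlebody_boundary`,
`stub_core_isSliceDiscIn_of_isMultiAttachment` (the only `sorry`s of the file) through the sorry-free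
composition above. [GompfScharlemannThompson2010, Prop. 2.3] -/
theorem VrlComponentsHBallSlice_of :
    Summit.SmoothPoincare4.SmoothPoincare4.Theses.VerlindeRLinks.VrlComponentsHBallSlice :=
  isHomotopyBallSlice_of_stubs stub_exists_disjoint_framedTubes stub_attachingMap_of_tube
    stub_isSurgery_boundary_of_isMultiAttachment stub_oneHandlebody_boundary
    stub_core_isSliceDiscIn_of_isMultiAttachment

end Summit.SmoothPoincare4.SmoothPoincare4.Cruxes.VrlComponentsHBallSlice.KirbyLemma21

end
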